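import Mathlib
import HarnessLib
import HarnessLib.Audit
import Summits.AtomisticToContinuum.Statement
import Summits.AtomisticToContinuum.FouriersLaw.Theorems.EmbeddedDrudeMourreNessUnique
import Summits.AtomisticToContinuum.FouriersLaw.Theorems.ContactEchoEpochsPinnedSteadyStateExists
import HarnessLib.Audit.Status.Attr

/-!
Route: ScaleFreeAnchor

DORMANT since 2026-08-23T10:34:29Z (reconciler: no traction for 6.1 d (last activity statement-grounded at 2026-08-17T08:13:49Z); parked, not closed — `ledger route dormant route-AtomisticToContinuum-ScaleFreeAnchor --off` to reactivate) — unstaffed, not closed; items shared with open routes are served there. `ledger route dormant <id> --off` reactivates.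

# Route ScaleFreeAnchor — scale-free quartic anchor (T = ∞ end by exact conjugacy) + continuation in
η = (βT)^(-1/2) + downward closure — conforming refiling of ScaleFreeQuarticAnchor

HISTORY. Second filing of card scale-free-quartic-anchor: route ScaleFreeQuarticAnchor (opened
2026-08-15T11:15Z) was retired 13:46Z `not-a-thesis` solely because its Assembly item concluded the
Literature decl `Literature.MathematicalPhysics.KineticTheory.HeatConduction.FouriersLaw` instead of
the sub-problem Statement decl `FouriersLaw` BY NAME (the two are definitionally equal). Here the
Assembly item AND the deciding theorem `closes` conclude `FouriersLaw`; the items are re-filed with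
the SAME signatures, so EtaContinuation, LowTClosure, NessUnique and PinnedSteadyStateExists are
shared verbatim with route PorousMediumCorner (stmt-AtomisticToContinuum-9792 / 9793 / 0741 / 9900),
which is the ALTERNATIVE DECOMPOSITION of this route's rank-2 crux AnchorFourier through the
infinite-volume Green–Kubo object (AnchorFourier is the conclusion of its planner theorem
anchorFourier_of_cruxes).
It suffices to show X = X_A ∧ X_η ∧ X_low ∧ X_(i):
X_A (AnchorFourier): the doubly-homogeneous quartic chain ⟨U = lam·q⁴/4, V = r⁴/4, γ⟩ (=
pureQuarticChain lam γ, pureQuarticChain_eq_mk) — the T = ∞ end of the conjunct under the PROVED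
amplitude conjugacy κ_{lam,β}(T) = κ_{lamT,βT}(1)
(Literature.Barriers.AtomisticToContinuum.LowTemperatureWeakAnharmonicity,
lowTemperatureWeakAnharmonicity_holds) composed with the time rescaling (q, p, t) ↦ (q, b·p, t/b) —
has a positive Bonetto–Lebowitz–Rey-Bellet conductivity function for every lam, γ > 0 (clause (ii)
of FouriersLawFor; = OscillatorChain.HasConductivity with κ > 0, written inline). By exact
self-similarity H₀(aq, a²p) = a⁴H₀(q, p) this is a ONE-temperature statement: D_N(T, γ) =
T^{1/4}·D_N(1, γT^{-1/4}) and κ(T) = κ(1)·T^{1/4} (support AnchorSelfSimilarity); it is non-vacuous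
at every N because the anchor's weak steady states EXIST (PROVED in tree:
Literature.MathematicalPhysics.KineticTheory.HeatConduction.CuneoEckmannHairerReyBellet2018_pureQuarticChain_holds
+ .exists_isSteadyState_mk).
X_η (EtaContinuation, anchor stability): X_A at pinning ratio lam/β (all frictions) implies that
pinnedChain ω₂ lam β γ obeys Fourier's law POINTWISE (∃ k > 0 with the HasConductivityAt clause,
inline) at every T above some T₁(ω₂, lam, β, γ). Dictionary (supports TimeRescaling +
QuarticAmplitudeScaling): pinnedChain ω₂ lam β γ at temperature T is conjugate to the temperature-1
chain U = ηω₂Q²/2 + (lam/β)Q⁴/4, V = ηR²/2 + R⁴/4 with friction γη^{1/2}, η = (βT)^{-1/2}, and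
D_N^{pinned}(T) = (βT)^{1/4}·D_N^{η}(1); T → ∞ is η → 0, a harmonic perturbation of the anchor that
is small in Gibbs measure though singular at small amplitude.
X_low (LowTClosure): if Fourier's law holds pointwise on a tail T > T₁ then it holds at every T > 0
— the weakly-anharmonic / kinetic side; NOT this card's mechanism, filed so that the assembly is
honest and as the plug-in point for route KineticCorner's deliverable (via ThermodynamicLimit
stmt-AtomisticToContinuum-0742 + FiniteResponseOfUnique stmt-AtomisticToContinuum-0717).
X_(i): NessUnique (weak-class uniqueness of the NESS of pinnedChain, shared
stmt-AtomisticToContinuum-0741) and PinnedSteadyStateExists (clause-(i) existence, shared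
stmt-AtomisticToContinuum-9900; provable now from
Literature.MathematicalPhysics.KineticTheory.HeatConduction.pinnedChain_exists_isSteadyState).
'Fourier's law holds pointwise at T for a chain P with constant k' means: ∀ steady-state families μ
(defined at all N, T_L, T_R > 0), ∃ D : ℕ → ℝ, (∀ N, totalCurrent(μ N (T+δ/2) (T−δ/2))/δ → D N as δ
→ 0, δ ≠ 0) ∧ D N → k — literally OscillatorChain.HasConductivityAt P T k (ConductivityAt.lean,
hasConductivityAt_iff), kept inline in the items for verbatim sharing.
Lean: `AnchorFourier ∧ EtaContinuation ∧ LowTClosure ∧ NessUnique ∧ PinnedSteadyStateExists`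

## Assembly
Pure logic + choice, VERIFIED rc 0 (no sorry; axioms propext / Classical.choice / Quot.sound) in the
planner's Sketch.lean as `theorem closes (h₁ : AnchorFourier) (h₂ : EtaContinuation) (h₃ :
LowTClosure) (h₄ : NessUnique) (h₅ : PinnedSteadyStateExists) : FouriersLaw` (12 lines) and supplied
as glue.lean: fix ω₂ lam β γ > 0; clause (i): PinnedSteadyStateExists gives μ, NessUnique gives ν =
μ for every other steady state; clause (ii): AnchorFourier at (lam/β, γ') for every γ' > 0 is
literally the hypothesis of EtaContinuation, whence ∃ T₁ ∀ T > T₁ pointwise Fourier; LowTClosure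
extends this to every T > 0; `choose!` the pointwise constants into κ : ℝ → ℝ (positivity and the (∃
D, limits) clause by the chosen specs). The conclusion is the sub-problem Statement decl
`FouriersLaw` (root abbrev of Summits/AtomisticToContinuum/FouriersLaw/Statement.lean) BY NAME.
HighTFourier = AnchorFourier + EtaContinuation (highT_of_anchor_eta) and closes_of_highT :
HighTFourier → LowTClosure → NessUnique → PinnedSteadyStateExists → FouriersLaw are checked in the
same sketch. Provers of PinnedSteadyStateExists import
Literature.MathematicalPhysics.KineticTheory.LangevinChainNESSHolds in their Theorems file; this
Theses file imports only the Statement.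

Rationale: WHY THIS LINE. The conjunct's family has exactly one corner with an exact SYMMETRY instead of a
small parameter: by the proved scaling conjugacy (AokiLukkarinenSpohn2006 §2 (2.8)–(2.13); tree:
fouriersLawFor_smul_iff, hasConductivity_of_smul, hasConductivityAt_iff_unit_temperature) high
temperature at fixed couplings is strong quartic coupling at temperature 1, and after the time
rescaling the T = ∞ end is the parameter-free, exactly self-similar chain H₀ = Σ p²/2 + lam q⁴/4 + Σ
r⁴/4, in which no near-integrable low-energy regime exists and κ₀(T) = κ₀(1)T^{1/4} is forced
(physics-level power laws LiLi2013 doi:10.1103/physreve.87.042125, LiLi2007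
doi:10.1209/0295-5075/78/34001; the 'purely quartic lattice' practice of Lepri–Livi–Politi
doi:10.1103/physreve.68.067102, used only for the UNPINNED anomalous chain). The route is a REGIME
DECOMPOSITION of the temperature axis (thought-starters 8/29/31: regime split + exactly self-similar
member + continuation): prove BLR's clause (ii) first for the anchor — one temperature, one number
per lam, a renormalisation fixed point by construction (block coarse-graining composed with the
exact rescaling maps the temperature-1 model to itself, so a multiscale proof controls ONE scale
step with no running couplings) — continue it in η = (βT)^{-1/2} to a high-temperature tail of the
conjunct's chain (the harmonic terms η(ω₂Q² + R²)/2 are relevant only at amplitudes ≲ η^{1/2}, of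
vanishing Gibbs weight; fixed-N parameter response HairerMajda2009 arXiv:0909.4313, NESS theory
CuneoEckmannHairerReyBellet2018 arXiv:1712.09413), and glue with a downward-closure crux owning the
kinetic corner. Imported from elsewhere: nothing beyond dimensional analysis / RG fixed-point
language and fixed-N NESS perturbation theory; the line has no transport mechanism of its own
(honestly said): AnchorFourier is the cleanest single instance on which any N-uniform engine is
first run — route PorousMediumCorner's infinite-volume Green–Kubo split is one, resistance
sub/superadditivity certificates and spatial transfer gaps (retired routes FeketeResistance,
SuperadditiveJunction, SpatialSlowManifold; cards still open) are others, each with a single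
parameter-free instance here. Versus the open routes: FourierGreenKubo is T-pointwise Green–Kubo on
the conjunct's model with no anchor and no continuation structure; KineticCorner owns the opposite
corner and files the upward continuation it cannot attack (KineticCornerComplement) exactly as this
route files LowTClosure; PorousMediumCorner decomposes AnchorFourier and re-uses X_η, X_low
verbatim. Because FouriersLawFor bundles ALL temperatures and the η-family is self-conjugate,
'FouriersLawFor of the η-chain for small η' would be the whole conjunct; the cut is therefore made
INSIDE clause (ii), pointwise in T.

RANKED CRUXES. #2 AnchorFourier (crux) — ANCHOR FOURIER (card item 3; clause (ii) only; verbatim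
signature of stmt-AtomisticToContinuum-3279): for the doubly-homogeneous quartic chain ⟨U = lam
q⁴/4, V = r⁴/4, friction γ⟩ with lam, γ > 0 there is κ : ℝ → ℝ, positive on (0,∞), which is a BLR
conductivity function — for every steady-state family and every T > 0 the finite-N responses D_N =
lim_{δ→0} totalCurrent(μ_{N,T+δ/2,T−δ/2})/δ exist and D_N → κ(T). By exact self-similarity (support
AnchorSelfSimilarity) equivalent to the single-temperature statement at T = 1 for all frictions, and
then κ(T) = κ(1)T^{1/4}. Non-vacuous: the anchor's weak steady states exist at every N (PROVED,
CuneoEckmannHairerReyBellet2018_pureQuarticChain_holds + exists_isSteadyState_mk); weak-class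
uniqueness for the anchor is not needed by the assembly (it is PorousMediumCorner's AnchorNess,
stmt-AtomisticToContinuum-9796). Route PorousMediumCorner's cruxes imply this statement (its planner
theorem anchorFourier_of_cruxes), so either line closes it. [difficulty: open-problem] (why it might
fail: No small parameter: N-uniform control of D_N is open for every deterministic anharmonic chain
(HasBoundedResponse applies squarely); a=b=4 is the uninvestigated marginal case of the DRH
bad-transport criterion; lam→0 end = anomalous unpinned quartic FPU chain, lam→∞ a near-insulating
desert.) [BonettoLebowitzReyBellet2000 §5.3 (33) and §10 item 1, arXiv:1904.07742 §3
(DeRoeckHuveneers2019), doi:10.1103/physreve.87.042125 (LiLi2013), AokiKusnezov2001,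
LukkarinenSpohn2008, decl Literature.Barriers.AtomisticToContinuum.HasBoundedResponse, decl
Literature.MathematicalPhysics.KineticTheory.HeatConduction.CuneoEckmannHairerReyBellet2018_pureQuarticChain_holds]
#3 EtaContinuation (crux) — ETA-CONTINUATION = ANCHOR STABILITY (card item 4, re-typed pointwise in
T; verbatim signature of stmt-AtomisticToContinuum-9792, shared with PorousMediumCorner): for ω₂,
lam, β, γ > 0, IF the anchor at pinning ratio lam/β has a positive conductivity function for EVERY
friction γ' > 0 (the body of AnchorFourier at (lam/β, γ')), THEN there is T₁ such that for every T >
T₁ the conjunct's chain pinnedChain ω₂ lam β γ has a positive pointwise conductivity k(T)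
(HasConductivityAt clause, inline). Dictionary: at temperature T the conjunct's chain is conjugate
(TimeRescaling with b = (βT)^{1/4} after QuarticAmplitudeScaling with s = (βT)^{-1/2}… i.e. η =
(βT)^{-1/2}) to the temperature-1 chain U = ηω₂Q²/2 + (lam/β)Q⁴/4, V = ηR²/2 + R⁴/4 with friction
γη^{1/2}; the claim is stability of the anchor's Fourier package under this harmonic perturbation
for η ≤ η₀, uniformly enough in the friction to cover γη^{1/2}. [deps: AnchorFourier] [difficulty:
open-problem] (why it might fail: The harmonic perturbation η(ω₂Q²+R²)/2 is singular at small
amplitude (well-bottom frequency 0→√(ηω₂)): cold regions may be non-perturbative Griffiths-type weak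
links; N-uniform response to a Hamiltonian parameter is as unavailable as any N-uniform control;
rescaled friction γη^{1/2}→0 jointly.) [arXiv:cond-mat/0602082 §2 (2.8)-(2.13)
(AokiLukkarinenSpohn2006), arXiv:0909.4313 (HairerMajda2009), arXiv:1712.09413 §2.3
(CuneoEckmannHairerReyBellet2018), DeRoeckHuveneers2015, decl
Literature.Barriers.AtomisticToContinuum.LowTemperatureWeakAnharmonicity]
#4 LowTClosure (crux) — DOWNWARD CLOSURE IN TEMPERATURE (card item 5, the gluing crux; NOT this
card's mechanism; verbatim signature of stmt-AtomisticToContinuum-9793, shared with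
PorousMediumCorner): for ω₂, lam, β, γ > 0, if pinnedChain ω₂ lam β γ obeys Fourier's law pointwise
(same inline clause) at every T above some T₁, then it does so at every T > 0. By the conjugacy
κ_{lam,β}(T) = κ_{lamT,βT}(1) this is propagation from strong to weak anharmonic coupling at
temperature 1, ending in the kinetic (phonon-Boltzmann) corner owned by route KineticCorner (whose
Green–Kubo deliverable becomes pointwise BLR Fourier below some T₀ through ThermodynamicLimit
stmt-0742 + FiniteResponseOfUnique stmt-0717 + NessUnique); the middle range [T₀, T₁] has neither a
small parameter nor a symmetry (see Two-layer plan). [difficulty: open-problem] (why it might fail: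
T→0 is the harmonic/kinetic corner (κ≍(λT)⁻² predicted; scales ℓ₁~(λT)⁻²≪ℓ₂~(λT)^{-2p}); no
monotonicity/connectedness of the set of Fourier temperatures is known; an interior near-integrable
window would break it; as hard as the conjunct minus its high-T tail.) [arXiv:cond-mat/0602082 §3
(3.25)-(3.28) and §4 (AokiLukkarinenSpohn2006), BricmontKupiainen2007 §1, HuveneersLukkarinen2020,
decl Literature.Barriers.AtomisticToContinuum.LowTemperatureWeakAnharmonicity]
#9 NessUnique (support) — UNIQUENESS OF THE WEAK STEADY STATE (shared
stmt-AtomisticToContinuum-0741, ~25 routes): for pinnedChain ω₂ lam β γ (all > 0), every N and T_L,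
T_R > 0, any two measures in the weak Fokker–Planck class IsSteadyState coincide. Print: uniqueness
of the invariant measure of the Langevin semigroup (CuneoEckmannHairerReyBellet2018 Thm 2.13(1);
Carmona2007 Thm 1.1(iii)); the item additionally needs 'weak stationary FPK probability solution ⇒
P_t-invariant' for this hypoelliptic L with cubic drift. Gives clause (i) with
PinnedSteadyStateExists. [difficulty: L] [arXiv:1712.09413 Thm 2.13(1)
(CuneoEckmannHairerReyBellet2018), Carmona2007 Thm 1.1(iii)]
#9 PinnedSteadyStateExists (support) — CLAUSE (i) EXISTENCE (shared stmt-AtomisticToContinuum-9900):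
for pinnedChain ω₂ lam β γ (all > 0), every N and T_L, T_R > 0 a weak steady state exists. One line
from the in-tree theorem
Literature.MathematicalPhysics.KineticTheory.HeatConduction.pinnedChain_exists_isSteadyState
(LangevinChainNESSHolds.lean; Cuneo–Eckmann–Hairer–Rey-Bellet 2018 Thm 2.13, PROVED in tree) in a
Theorems file importing that module — taken as an ITEM so that this Theses file does not import the
Langevin-SDE cone (same design as PorousMediumCorner rev 3). [difficulty: provable-now]
[arXiv:1712.09413 Thm 2.13 (CuneoEckmannHairerReyBellet2018), decl
Literature.MathematicalPhysics.KineticTheory.HeatConduction.pinnedChain_exists_isSteadyState]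
#9 HighTFourier (support) — HIGH-TEMPERATURE FOURIER LAW, the card's deliverable as a standalone
node (verbatim stmt-AtomisticToContinuum-3282): for ω₂, lam, β, γ > 0 there is T₁ such that
pinnedChain ω₂ lam β γ obeys Fourier's law pointwise at every T > T₁. Equals AnchorFourier +
EtaContinuation by modus ponens at lam/β (planner proof highT_of_anchor_eta in Sketch.lean, rc 0);
with LowTClosure + NessUnique + PinnedSteadyStateExists it also decides the Statement
(closes_of_highT, rc 0) — so any other high-temperature method (porous-medium hydrodynamics, a
direct non-perturbative argument at large (lamT, βT)) can plug in here without the anchor. [deps: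
AnchorFourier, EtaContinuation] [difficulty: open-problem] [arXiv:cond-mat/0602082 §2
(AokiLukkarinenSpohn2006), doi:10.1103/physreve.87.042125 (LiLi2013)]
#9 TimeRescaling (support) — TIME-RESCALING CONJUGACY (verbatim stmt-AtomisticToContinuum-3283) for
a general chain ⟨U, V, γ⟩ and b > 0: under Φ(q, p) = (q, b·p) (time t ↦ t/b) a steady state of ⟨U,
V, γ⟩ at (T_L, T_R) pushes forward to a steady state of ⟨b²U, b²V, bγ⟩ at (b²T_L, b²T_R), and
totalCurrent scales by b³. Proof pattern: (L'f)∘Φ = b·L(f∘Φ) term by term in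
OscillatorChain.generator, bondCurrent'∘Φ = b³·bondCurrent, exactly as isSteadyState_map_smul /
totalCurrent_map_smul of LowTemperatureWeakAnharmonicity.lean (there for the amplitude map).
[difficulty: provable-now] [arXiv:cond-mat/0602082 §2 (2.8)-(2.10) (AokiLukkarinenSpohn2006),
BonettoLebowitzReyBellet2000 §4.1 (10), decl
Literature.Barriers.AtomisticToContinuum.HeatConduction.isSteadyState_map_smul]
#9 QuarticAmplitudeScaling (support) — AMPLITUDE SCALING FOR THE FOUR-COEFFICIENT QUARTIC FAMILY
⟨Aq²/2 + Lq⁴/4, Cr²/2 + Br⁴/4, γ⟩ (verbatim stmt-AtomisticToContinuum-3284): for s ≠ 0 a steady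
state of the (Ls², Bs²) chain at (T_L, T_R) pushes forward under x ↦ s • x to a steady state of the
(L, B) chain at (s²T_L, s²T_R), totalCurrent scaling by s². Verbatim generalisation of the PROVED
isSteadyState_map_smul / totalCurrent_map_smul (the case A = ω₂, C = 1) to arbitrary harmonic
coefficients — needed at A = C = 0 (the anchor) and (A, C) = (ηω₂, η) (the η-family). [difficulty:
provable-now] [arXiv:cond-mat/0602082 §2 (2.11)-(2.13) (AokiLukkarinenSpohn2006), decl
Literature.Barriers.AtomisticToContinuum.HeatConduction.hasConductivity_of_smul]
#9 AnchorSelfSimilarity (support) — EXACT SELF-SIMILARITY OF THE ANCHOR (friction–temperature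
conjugacy; verbatim stmt-AtomisticToContinuum-3285): for lam, γ and s > 0, (a) FouriersLawFor ⟨lam
q⁴/4, r⁴/4, γ⟩ ↔ FouriersLawFor ⟨lam q⁴/4, r⁴/4, sγ⟩, and (b) every conductivity function κ' of the
friction-γ anchor yields the conductivity function T ↦ s·κ'(T/s⁴) of the friction-sγ anchor, i.e.
D_N(T, sγ) = s·D_N(T/s⁴, γ); at s⁴ = T: D_N(T, γ) = T^{1/4}·D_N(1, γT^{-1/4}) and κ(T) =
κ(1)T^{1/4}. Bookkeeping from TimeRescaling (b = s) and QuarticAmplitudeScaling (A = C = 0,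
amplitude s). So the anchor's only genuine parameter is lam (= lam/β of the conjunct). [deps:
TimeRescaling, QuarticAmplitudeScaling] [difficulty: provable-now] [arXiv:cond-mat/0602082 §2
(2.12)-(2.13) (AokiLukkarinenSpohn2006), doi:10.1103/physreve.87.042125 (LiLi2013)]

TWO-LAYER PLAN. Foreseen glued splits (k ≤ 3, depth 1; nothing filed now). AnchorFourier ⇐
AnchorBounded (N-uniform two-sided bound on D_N at T = 1, all γ) → AnchorPositiveLimit (lim inf > 0
and existence of lim, e.g. by quasi-sub/superadditivity of resistances) → AnchorFourier; the
alternative decomposition through the infinite-volume object (AnchorAbelGreenKubo →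
AnchorThermodynamicLimit → AnchorFourier) is ALREADY route PorousMediumCorner and stays there.
EtaContinuation ⇐ EtaDictionary (the conjugacy pinnedChain@T ≅ η-chain@1, provable now from
TimeRescaling + QuarticAmplitudeScaling) → EtaStability (∃ η₀(ω₂, lam/β): pointwise Fourier at
temperature 1 for the η-chain, η ≤ η₀, all frictions) → EtaContinuation. LowTClosure ⇐
KineticCornerBLR (∃ T₀ > 0, pointwise BLR Fourier for 0 < T < T₀: KineticCorner's target pushed
through ThermodynamicLimit 0742 + FiniteResponseOfUnique 0717 + NessUnique) → MidRangeBridge (corner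
below T₀ ∧ tail above T₁ ⇒ every T: the no-structure middle, a compact range in log T) →
LowTClosure.

KILL CRITERIA. A proof that the anchor is anomalous or insulating for some lam > 0 (¬AnchorFourier:
D_N unbounded or → 0 for ⟨lam q⁴/4, r⁴/4, γ⟩ at one temperature, hence all) closes the route (`close
--reason refuted:AnchorFourier`) and, via the conjugacy, says the conjunct's κ(T)/T^{1/4} has no
finite positive limit as T → ∞ — informative for every line, and it breaks PorousMediumCorner too. A
refutation of EtaContinuation with AnchorFourier standing (Fourier at T = ∞ but not on a high-T
tail) forces a pivot: file HighTFourier as the rank-3 crux directly (non-perturbative high-T) and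
drop the η-perturbation reading. Refutation of LowTClosure by an interior anomalous temperature
refutes the conjunct itself (file ¬FouriersLaw, hand the witness to the refutation side).
HighTFourier proved elsewhere moots #2–#3 for the summit (the anchor items stay as Literature-grade
targets); FouriersLaw proved by FourierGreenKubo/KineticCorner+complement moots the route.

NOT DECOMPOSED YET. The engine for AnchorFourier (bounded vs positive-limit halves; which N-uniform
mechanism: resistance certificates, spatial transfer gap, hydrodynamic limit — PorousMediumCorner
holds the Green–Kubo split); the perturbation scheme of EtaContinuation (openness of the good-η set
at η = 0 vs a direct two-scale argument) and its friction-uniformity (expected T₁ = T₁(ω₂, lam, β),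
cf. the parity bound |∂log D_N/∂log γ| ≤ 1 of card gamma-parity-contacts-forgotten); the
corner/middle split of LowTClosure (waits for KineticCorner's target); weak-class NESS uniqueness
for the anchor (not needed here; PorousMediumCorner's AnchorNess). All are layer-2 children, filed
by `route edit --split` when a crux closes or a prover proposes the split.

CHEAPEST FALSIFIER. (a) Lookup — DONE and now settled in tree: does the NESS theory exclude V = r⁴/4
(V″(0) = 0)? No: arXiv:1712.09413 Ex. 2.5/2.8 cover it, and the tree PROVES the anchor's weak steady
states exist (CuneoEckmannHairerReyBellet2018_pureQuarticChain_holds,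
PureQuarticChainNESSProofs.lean) — the card's feared demotion to 'NESS existence open' is gone. (b)
Numerics (kit; not run — plancard unit, hub compute-free): simulate ⟨q⁴/4, r⁴/4, γ = 1⟩ between
Langevin baths at T = 1 and T = 16 — profiles must coincide after the exact rescaling (code/concept
check), N·J_N/δT must saturate in N, and D_N(T, γ) = T^{1/4}·D_N(1, γT^{-1/4}) must hold
identically; a growing D_N ∝ N^α at lam = 1 (the lam → 0 end IS the anomalous purely quartic FPU
chain, α ≈ 2/5, LNP 921 ch. 6; LukkarinenSpohn2008_lemma41) kills #2 cheaply, so scan lam ∈ {1/4, 1,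
4} at N ≤ 2048. (c) For #3: the same code with the η-chain at η ∈ {0, 0.05, 0.2}: D_N(η)/D_N(0) must
stay bounded in N.

NUMBERS. Anchor: ⟨kinetic⟩ = 2⟨potential⟩ per degree of freedom in equilibrium (virial, degree-4
homogeneity), e(T) = ¾T; κ₀(T) = κ₀(1)T^{1/4}; D_N(T, γ) = T^{1/4}·D_N(1, γT^{-1/4}); conjunct ↔
η-chain: η = (βT)^{-1/2}, friction γ(βT)^{-1/4}, D_N^{pinned}(T) = (βT)^{1/4}·D_N^{η}(1); smallness
parameters of the continuation: ω₂²/(lamT) and 1/(βT). De Roeck–Huveneers bad-transport criterion a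
> b (pinning degree vs coupling degree, arXiv:1904.07742 §3): the anchor sits at the marginal a = b
= 4. Kinetic corner (not ours): κ ≍ C(λT)⁻² predicted (AokiLukkarinenSpohn2006 (3.28), c(0) ≈
0.2756). Items at open: 10 (3 cruxes, 6 supports, 1 assembly).

DEFINITION REQUESTS. None. Gen 1's request OscillatorChain.HasConductivityAt LANDED
(Literature/MathematicalPhysics/KineticTheory/ConductivityAt.lean, with
hasConductivity_iff_forall_hasConductivityAt, exists_hasConductivity_of_forall_hasConductivityAt,
hasConductivityAt_iff_unit_temperature); the items nevertheless keep the clause INLINE — (1)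
verbatim sharing with PorousMediumCorner's stmt-9792/9793 by signature dedup, (2)
ConductivityAt.lean imports
Literature.Barriers.AtomisticToContinuum.LowTemperatureWeakAnharmonicity, which carries the
@[conjecture] AokiLukkarinenSpohn2006_kineticLowTemperature_prediction into the import cone although
no item uses it (PorousMediumCorner's route-repair removed that import for the same reason).
pureQuarticChain (QuarticRingChain.lean) LANDED; items keep the anonymous constructor
(pureQuarticChain_eq_mk is rfl) for the same sharing reason. Provers may freely rewrite with these
lemmas in Theorems files.

Novelty: Searches (2026-08-15, this planner, gen 2): `lit galaxy search "purely quartic chain" --star all` (1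
hit: pdf:-9186583916445228240, Sen–Krishna Mohan PRE 79 (2009) 'Dynamics of metastable breathers in
nonlinear chains in acoustic vacuum' — UNPINNED purely nonlinear chains, breather lifetimes, no
transport coefficient; relevant only as folklore for the lam → 0 end); `lit galaxy search "quartic
pinning potential heat" --star all` and `"scale-free lattice thermal conductivity" --star all` (0
hits each); `lit search --hybrid "purely quartic lattice thermal conductivity temperature dependence
pinned anharmonic chain scaling"` and `lit search "quartic lattice thermal conductivity temperature
dependence scaling homogeneous potential" --source all` — searchd/graph service UNAVAILABLE
18:35Z–18:47Z (D-0023 off-box; logged, retried three times); `ledger negatives --problem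
AtomisticToContinuum` (6, none in FouriersLaw); in tree (lean search): ConductivityAt.lean
(HasConductivityAt landed from gen 1), QuarticRingChain.lean + PureQuarticChainNESS(.Proofs).lean
(pureQuarticChain, anchor NESS existence PROVED), the six open FouriersLaw route files
(PorousMediumCorner shares 4 items and decomposes AnchorFourier; KineticCorner is the opposite
corner; FourierGreenKubo, BondHeatUncertainty, CurrentTiltQuench, OddSectorIrreversibility have no
anchor/continuation structure), the 48 retired Theses (AffineAnchor, BarenblattAnchor,
PorousMediumAnchor were anchor-engine drafts, all re-absorbed into  [refs: 10.1103/physreve.87.042125, 10.1209/0295-5075/78/34001, 10.1103/physreve.68.067102, 10.1002/cpa.20280, 1712.09413, 1904.07742, cond-mat/0602082, doi:10.1103/physreve.87.042125, doi:10.1209/0295-5075/78/34001, doi:10.1103/physreve.68.067102, doi:10.1002/cpa.20280, AokiLukkarinenSpohn2006, LiLi2013, LiLi2007, HairerMattingly2009, BricmontKupiainen2013]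

Barriers (technique_class: scale-invariance-anchor, continuation-in-eta, regime-decomp): - technique_class: scale-invariance-anchor, continuation-in-eta, regime-decomp
- Literature.Barriers.AtomisticToContinuum.LowTemperatureWeakAnharmonicity: the route is BUILT on
this entry's proved conjugacy and owns the OPPOSITE corner (lamT, βT → ∞); AnchorFourier and
EtaContinuation make no claim uniform as T → 0 (inside the anchor family there is no harmonic limit
point at all). LowTClosure does NOT evade it: it is the honest gluing crux for the kinetic corner;
the bet is only that the barrier kills T-UNIFORM bounds (κ ≍ (λT)⁻²) while LowTClosure asks
pointwise statements, which the entry's scope caveats leave open.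
- Literature.Barriers.AtomisticToContinuum.HarmonicChainBallisticFlux: not touched — the anchor has
no quadratic part; the continuation adds a SMALL harmonic part to a quartic model, the reverse of
perturbing the ballistic harmonic chain; AnchorFourier is stated for lam > 0 and the conjunct's
parameters stay > 0 throughout.
- Literature.Barriers.AtomisticToContinuum.HasBoundedResponse: applies squarely to AnchorFourier
(hasBoundedResponse_of_fouriersLawFor: any proof must control D_N uniformly in N, which no fixed-N
tool does). It does not evade it; the bet is that the anchor is the cleanest instance on which an
N-uniform engine can first be run — one temperature, no parameter but lam, finite computations with
a single instance, every estimate proved at T = 1 holding at all T.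
- Literature.Barriers.AtomisticToContinuum.BeckerMenegaki2022_gapClosing: fixed-N spe

History (route lifecycle, newest last):
- 2026-08-15T19:40:59Z · rev 2: restated Assembly (stmt-AtomisticToContinuum-11832) — route-repair step 3: un-block Assembly (stmt-AtomisticToContinuum-11832 rendered as BLOCKED TODO at rev 1; the block is sticky and an identical restatement is r (planner-rrepair-AtomisticToContinuum-ScaleFree-544f5b69-0)
- 2026-08-23T10:34:29Z · DORMANT — reconciler: no traction for 6.1 d (last activity statement-grounded at 2026-08-17T08:13:49Z); parked, not closed — `ledger route dormant route-AtomisticToContin (operator:999:1316664)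

sub-problem: FouriersLaw · status: dormant · opened planner-plancard-AtomisticToContinuum-Fourier-c07f6739-g2-0 2026-08-15T18:44:24Z · rev 2 · ledger route-AtomisticToContinuum-ScaleFreeAnchor
GENERATED by the gate from the ledger (D-0016/17). Provers cite these decls: `theorem foo : Summit.AtomisticToContinuum.FouriersLaw.Theses.ScaleFreeAnchor.<Decl> := …` in Summits/AtomisticToContinuum/FouriersLaw/Theorems/<Name>.lean.
-/

namespace Summit.AtomisticToContinuum.FouriersLaw.Theses.ScaleFreeAnchor

open scoped BigOperators Topology Manifold Classical MeasureTheory ProbabilityTheory Matrix InnerProductSpace ComplexConjugate ContinuousMap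
open Filter Set Function TopologicalSpace MeasureTheory

attribute [summit_statement] _root_.FouriersLaw

/-- item stmt-AtomisticToContinuum-11827 · crux · rank 2 · open · by planner
why it might fail: No small parameter: N-uniform control of D_N is open for every deterministic anharmonic chain (HasBoundedResponse applies squarely); a=b=4 is the uninvestigated marginal case of the DRH bad-transport criterion; lam→0 end = anomalous unpinned quartic FPU chain, lam→∞ a near-insulating desert.
sources: BonettoLebowitzReyBellet2000 §5.3 (33) and §10 item 1, arXiv:1904.07742 §3 (DeRoeckHuveneers2019), doi:10.1103/physreve.87.042125 (LiLi2013), AokiKusnezov2001, LukkarinenSpohn2008, decl Literature.Barriers.AtomisticToContinuum.HasBoundedResponse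
[crux] ANCHOR FOURIER (card item 3; clause (ii) only; verbatim signature of
stmt-AtomisticToContinuum-3279): for the doubly-homogeneous quartic chain ⟨U = lam q⁴/4, V = r⁴/4,
friction γ⟩ with lam, γ > 0 there is κ : ℝ → ℝ, positive on (0,∞), which is a BLR conductivity
function — for every steady-state family and every T > 0 the finite-N responses D_N = lim_{δ→0}
totalCurrent(μ_{N,T+δ/2,T−δ/2})/δ exist and D_N → κ(T). By exact self-similarity (support
AnchorSelfSimilarity) equivalent to the single-temperature statement at T = 1 for all frictions, and
then κ(T) = κ(1)T^{1/4}. Non-vacuous: the anchor's weak steady states exist at every N (PROVED,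
CuneoEckmannHairerReyBellet2018_pureQuarticChain_holds + exists_isSteadyState_mk); weak-class
uniqueness for the anchor is not needed by the assembly (it is PorousMediumCorner's AnchorNess,
stmt-AtomisticToContinuum-9796). Route PorousMediumCorner's cruxes imply this statement (its planner
theorem anchorFourier_of_cruxes), so either line closes it. [difficulty: open-problem] -/
@[route_item "route-AtomisticToContinuum-ScaleFreeAnchor", crux]
def AnchorFourier : Prop :=
  ∀ lam γ : ℝ, 0 < lam → 0 < γ → ∃ κ : ℝ → ℝ, (∀ T : ℝ, 0 < T → 0 < κ T) ∧ ∀ μ : (N : ℕ) → ℝ → ℝ → MeasureTheory.Measure (Literature.MathematicalPhysics.KineticTheory.HeatConduction.PhaseSpace N), (∀ (N : ℕ) (T_L T_R : ℝ), 0 < T_L → 0 < T_R → (⟨fun q => lam * q ^ 4 / 4, fun r => r ^ 4 / 4, γ⟩ : Literature.MathematicalPhysics.KineticTheory.HeatConduction.OscillatorChain).IsSteadyState N T_L T_R (μ N T_L T_R)) → ∀ T : ℝ, 0 < T → ∃ D : ℕ → ℝ, (∀ N : ℕ, Filter.Tendsto (fun δ : ℝ => (⟨fun q => lam * q ^ 4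 / 4, fun r => r ^ 4 / 4, γ⟩ : Literature.MathematicalPhysics.KineticTheory.HeatConduction.OscillatorChain).totalCurrent (μ N (T + δ / 2) (T - δ / 2)) / δ) (nhdsWithin 0 {(0 : ℝ)}ᶜ) (nhds (D N))) ∧ Filter.Tendsto D Filter.atTop (nhds (κ T))

/-- item stmt-AtomisticToContinuum-9792 · crux · rank 3 · open · by planner
why it might fail: The harmonic perturbation η(ω₂Q²+R²)/2 is singular at small amplitude (well-bottom frequency 0→√(ηω₂)): cold regions may be non-perturbative Griffiths-type weak links; N-uniform response to a Hamiltonian parameter is as unavailable as any N-uniform control; rescaled friction γη^{1/2}→0 jointly.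
sources: arXiv:cond-mat/0602082 §2 (2.8)-(2.13) (AokiLukkarinenSpohn2006), arXiv:0909.4313 (HairerMajda2009), arXiv:1712.09413 §2.3 (CuneoEckmannHairerReyBellet2018), DeRoeckHuveneers2015, decl Literature.Barriers.AtomisticToContinuum.LowTemperatureWeakAnharmonicity
[crux] η-CONTINUATION = ANCHOR STABILITY — verbatim the item EtaContinuation of route
ScaleFreeQuarticAnchor (stmt-AtomisticToContinuum-3280, its ledger signature with
OscillatorChain.HasConductivity unfolded; shared by signature): for ω₂, lam, β, γ > 0, IF the anchor
at pinning ratio lam/β has a positive BLR conductivity function for every friction γ' (the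
AnchorFourier instance, which this route derives from AnchorAbelGreenKubo + AnchorDilationCovariance
+ AnchorThermodynamicLimit + AnchorNess + AnchorFiniteResponse), THEN there is T₁ such that for
every T > T₁ the conjunct's chain pinnedChain ω₂ lam β γ obeys Fourier's law pointwise at T (∃ k >
0, ∀ steady-state families, ∃ D, responses → D N and D N → k). Dictionary: pinnedChain at T ≅ H_η =
anchor(lam/β) + η(ω₂Q² + R²)/2 at temperature 1, friction γη^(1/2), η = (βT)^(−1/2); the
porous-medium reading adds that the perturbation is relevant exactly at the COLD amplitudes where
D_th ∝ e^(1/4) degenerates (Barenblatt fronts), i.e. where local equilibrium is most fragile. [deps: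
AnchorThermodynamicLimit] [difficulty: open-problem] -/
@[route_item "route-AtomisticToContinuum-ScaleFreeAnchor", crux]
def EtaContinuation : Prop :=
  ∀ ω₂ lam β γ : ℝ, 0 < ω₂ → 0 < lam → 0 < β → 0 < γ → (∀ γ' : ℝ, 0 < γ' → ∃ κ₀ : ℝ → ℝ, (∀ T : ℝ, 0 < T → 0 < κ₀ T) ∧ ∀ μ : (N : ℕ) → ℝ → ℝ → MeasureTheory.Measure (Literature.MathematicalPhysics.KineticTheory.HeatConduction.PhaseSpace N), (∀ (N : ℕ) (T_L T_R : ℝ), 0 < T_L → 0 < T_R → (⟨fun q => lam / β * q ^ 4 / 4, fun r => r ^ 4 / 4, γ'⟩ : Literature.MathematicalPhysics.KineticTheory.HeatConduction.OscillatorChain).IsSteadyState N T_L T_R (μ N T_L T_R)) → ∀ T : ℝ, 0 < T → ∃ D : ℕ → ℝ, (∀ N : ℕ, Filter.Tendsto (fun δ : ℝ => (⟨fun q => lam / β * q ^ 4 / 4, fun r => r ^ 4 / 4, γ'⟩ : Literature.MathematicalPhysics.KineticTheory.HeatConduction.OscillatorChain).totalCurrent (μ N (T + δ / 2) (T - δ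 / 2)) / δ) (nhdsWithin 0 {(0 : ℝ)}ᶜ) (nhds (D N))) ∧ Filter.Tendsto D Filter.atTop (nhds (κ₀ T))) → ∃ T₁ : ℝ, ∀ T : ℝ, T₁ < T → ∃ k : ℝ, 0 < k ∧ ∀ μ : (N : ℕ) → ℝ → ℝ → MeasureTheory.Measure (Literature.MathematicalPhysics.KineticTheory.HeatConduction.PhaseSpace N), (∀ (N : ℕ) (T_L T_R : ℝ), 0 < T_L → 0 < T_R → (Literature.MathematicalPhysics.KineticTheory.HeatConduction.pinnedChain ω₂ lam β γ).IsSteadyState N T_L T_R (μ N T_L T_R)) → ∃ D : ℕ → ℝ, (∀ N : ℕ, Filter.Tendsto (fun δ : ℝ => (Literature.MathematicalPhysics.KineticTheory.HeatConduction.pinnedChain ω₂ lam β γ).totalCurrent (μ N (T + δ / 2) (T - δ / 2)) / δ) (nhdsWithin 0 {(0 : ℝ)}ᶜ) (nhds (D N))) ∧ Filter.Tendsto D Filter.atTop (nhds k)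

/-- item stmt-AtomisticToContinuum-9793 · crux · rank 4 · open · by planner
why it might fail: T→0 is the harmonic/kinetic corner (κ≍(λT)⁻² predicted; scales ℓ₁~(λT)⁻²≪ℓ₂~(λT)^{-2p}); no monotonicity/connectedness of the set of Fourier temperatures is known; an interior near-integrable window would break it; as hard as the conjunct minus its high-T tail.
sources: arXiv:cond-mat/0602082 §3 (3.25)-(3.28) and §4 (AokiLukkarinenSpohn2006), BricmontKupiainen2007 §1, HuveneersLukkarinen2020, decl Literature.Barriers.AtomisticToContinuum.LowTemperatureWeakAnharmonicity
[crux] DOWNWARD CLOSURE IN TEMPERATURE — verbatim the item LowTClosure of route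
ScaleFreeQuarticAnchor (stmt-AtomisticToContinuum-3281; shared by signature; NOT this card's
mechanism): for ω₂, lam, β, γ > 0, if pinnedChain ω₂ lam β γ obeys Fourier's law pointwise at every
T above some T₁, then it does so at every T > 0 — propagation from strong to weak anharmonic
coupling at temperature 1 under the conjugacy, ending in the kinetic corner; plug-in point for
kinetic-regime routes (KineticCorner, DrudeMourre via AbelThermodynamicLimit) or for N-uniform
regularity in T (cards complete-analyticity-vitali-propagation,
countable-temperatures-suffice-equicontinuity). [deps: EtaContinuation] [difficulty: open-problem] -/
@[route_item "route-AtomisticToContinuum-ScaleFreeAnchor", crux]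
def LowTClosure : Prop :=
  ∀ ω₂ lam β γ : ℝ, 0 < ω₂ → 0 < lam → 0 < β → 0 < γ → (∃ T₁ : ℝ, ∀ T : ℝ, T₁ < T → ∃ k : ℝ, 0 < k ∧ ∀ μ : (N : ℕ) → ℝ → ℝ → MeasureTheory.Measure (Literature.MathematicalPhysics.KineticTheory.HeatConduction.PhaseSpace N), (∀ (N : ℕ) (T_L T_R : ℝ), 0 < T_L → 0 < T_R → (Literature.MathematicalPhysics.KineticTheory.HeatConduction.pinnedChain ω₂ lam β γ).IsSteadyState N T_L T_R (μ N T_L T_R)) → ∃ D : ℕ → ℝ, (∀ N : ℕ, Filter.Tendsto (fun δ : ℝ => (Literature.MathematicalPhysics.KineticTheory.HeatConduction.pinnedChain ω₂ lam β γ).totalCurrent (μ N (T + δ / 2) (T - δ / 2)) / δ) (nhdsWithin 0 {(0 : ℝ)}ᶜ) (nhds (D N))) ∧ Filter.Tendsto D Filter.atTop (nhds k)) → ∀ T : ℝ, 0 < T → ∃ k : ℝ, 0 < k ∧ ∀ μ : (N : ℕ) → ℝ → ℝ → MeasureTheory.Measure (Literature.MathematicalPhysics.KineticTheory.HeatConduction.PhaseSpace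 N), (∀ (N : ℕ) (T_L T_R : ℝ), 0 < T_L → 0 < T_R → (Literature.MathematicalPhysics.KineticTheory.HeatConduction.pinnedChain ω₂ lam β γ).IsSteadyState N T_L T_R (μ N T_L T_R)) → ∃ D : ℕ → ℝ, (∀ N : ℕ, Filter.Tendsto (fun δ : ℝ => (Literature.MathematicalPhysics.KineticTheory.HeatConduction.pinnedChain ω₂ lam β γ).totalCurrent (μ N (T + δ / 2) (T - δ / 2)) / δ) (nhdsWithin 0 {(0 : ℝ)}ᶜ) (nhds (D N))) ∧ Filter.Tendsto D Filter.atTop (nhds k)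

/-- item stmt-AtomisticToContinuum-0741 · support · rank 9 · closed · proved by Summit.AtomisticToContinuum.FouriersLaw.Theorems.nessUnique_proof (prover) · by planner
sources: arXiv:1712.09413 Thm 2.13(1) (CuneoEckmannHairerReyBellet2018), Carmona2007 Thm 1.1(iii)
[crux] UNIQUENESS OF THE WEAK STEADY STATE (the half of stmt-0706 not covered by the landed fact
Literature.MathematicalPhysics.KineticTheory.HeatConduction.CuneoEckmannHairerReyBellet2018_pinnedChain,
p3544): for pinnedChain ω₂ lam β γ (all > 0), every N and T_L, T_R > 0, any two measures in the weak
Fokker–Planck class IsSteadyState (probability, ∫ L f dμ = 0 for f ∈ C_c^∞, bond currents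
integrable) coincide. Print: uniqueness of the INVARIANT MEASURE of the Langevin semigroup
(CuneoEckmannHairerReyBellet2018 Thm 2.13(1): C1, C2, CA; Carmona2007 Thm 1.1(iii)); the item
additionally needs 'weak stationary probability solution of L*μ = 0 ⇒ P_t-invariant' for this
hypoelliptic L with cubic drift (Echeverría 1982 well-posed martingale problem on C_c^∞ +
non-explosion via e^{θH}; Bogachev–Krylov–Röckner–Shaposhnikov 2015 Ch. 5 is non-degenerate only) —
the FP-identification lemma is the formal crux. N = 0: PhaseSpace 0 is a point (unique probability
measure); N = 1: both baths on site 0, OU at temperature (T_L+T_R)/2. This is exactly the hypothesis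
of FiniteResponse and ThermodynamicLimit and, with the fact, gives clause (i) of FouriersLawFor. -/
@[route_item "route-AtomisticToContinuum-ScaleFreeAnchor", crux]
def NessUnique : Prop :=
  ∀ ω₂ lam β γ : ℝ, 0 < ω₂ → 0 < lam → 0 < β → 0 < γ → ∀ (N : ℕ) (T_L T_R : ℝ), 0 < T_L → 0 < T_R → ∀ μ ν : MeasureTheory.Measure (Literature.MathematicalPhysics.KineticTheory.HeatConduction.PhaseSpace N), (Literature.MathematicalPhysics.KineticTheory.HeatConduction.pinnedChain ω₂ lam β γ).IsSteadyState N T_L T_R μ → (Literature.MathematicalPhysics.KineticTheory.HeatConduction.pinnedChain ω₂ lam β γ).IsSteadyState N T_L T_R ν → μ = ν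

/-- `NessUnique` holds: proved by `Summit.AtomisticToContinuum.FouriersLaw.Theorems.nessUnique_proof`. -/
theorem NessUnique_holds : NessUnique := _root_.Summit.AtomisticToContinuum.FouriersLaw.Theorems.nessUnique_proof

/-- item stmt-AtomisticToContinuum-11828 · support · rank 9 · open · by planner
sources: arXiv:cond-mat/0602082 §2 (AokiLukkarinenSpohn2006), doi:10.1103/physreve.87.042125 (LiLi2013)
[support] HIGH-TEMPERATURE FOURIER LAW, the card's deliverable as a standalone node (verbatim
stmt-AtomisticToContinuum-3282): for ω₂, lam, β, γ > 0 there is T₁ such that pinnedChain ω₂ lam β γ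
obeys Fourier's law pointwise at every T > T₁. Equals AnchorFourier + EtaContinuation by modus
ponens at lam/β (planner proof highT_of_anchor_eta in Sketch.lean, rc 0); with LowTClosure +
NessUnique + PinnedSteadyStateExists it also decides the Statement (closes_of_highT, rc 0) — so any
other high-temperature method (porous-medium hydrodynamics, a direct non-perturbative argument at
large (lamT, βT)) can plug in here without the anchor. [deps: AnchorFourier, EtaContinuation]
[difficulty: open-problem] -/
@[route_item "route-AtomisticToContinuum-ScaleFreeAnchor"]
def HighTFourier : Prop :=
  ∀ ω₂ lam β γ : ℝ, 0 < ω₂ → 0 < lam → 0 < β → 0 < γ → ∃ T₁ : ℝ, ∀ T : ℝ, T₁ < T → ∃ k : ℝ, 0 < k ∧ ∀ μ : (N : ℕ) → ℝ → ℝ → MeasureTheory.Measure (Literature.MathematicalPhysics.KineticTheory.HeatConduction.PhaseSpace N), (∀ (N : ℕ) (T_L T_R : ℝ), 0 < T_L → 0 < T_R → (Literature.MathematicalPhysics.KineticTheory.HeatConduction.pinnedChain ω₂ lam β γ).IsSteadyState N T_L T_R (μ N T_L T_R)) → ∃ D : ℕ → ℝ, (∀ N : ℕ, Filter.Tendsto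 (fun δ : ℝ => (Literature.MathematicalPhysics.KineticTheory.HeatConduction.pinnedChain ω₂ lam β γ).totalCurrent (μ N (T + δ / 2) (T - δ / 2)) / δ) (nhdsWithin 0 {(0 : ℝ)}ᶜ) (nhds (D N))) ∧ Filter.Tendsto D Filter.atTop (nhds k)

/-- item stmt-AtomisticToContinuum-11829 · support · rank 9 · open · by planner
sources: arXiv:cond-mat/0602082 §2 (2.8)-(2.10) (AokiLukkarinenSpohn2006), BonettoLebowitzReyBellet2000 §4.1 (10), decl Literature.Barriers.AtomisticToContinuum.HeatConduction.isSteadyState_map_smul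
[support] TIME-RESCALING CONJUGACY (verbatim stmt-AtomisticToContinuum-3283) for a general chain ⟨U,
V, γ⟩ and b > 0: under Φ(q, p) = (q, b·p) (time t ↦ t/b) a steady state of ⟨U, V, γ⟩ at (T_L, T_R)
pushes forward to a steady state of ⟨b²U, b²V, bγ⟩ at (b²T_L, b²T_R), and totalCurrent scales by b³.
Proof pattern: (L'f)∘Φ = b·L(f∘Φ) term by term in OscillatorChain.generator, bondCurrent'∘Φ =
b³·bondCurrent, exactly as isSteadyState_map_smul / totalCurrent_map_smul of
LowTemperatureWeakAnharmonicity.lean (there for the amplitude map). [difficulty: provable-now] -/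
@[route_item "route-AtomisticToContinuum-ScaleFreeAnchor"]
def TimeRescaling : Prop :=
  ∀ (U V : ℝ → ℝ) (γ b : ℝ), 0 < b → ∀ (N : ℕ) (T_L T_R : ℝ) (μ : MeasureTheory.Measure (Literature.MathematicalPhysics.KineticTheory.HeatConduction.PhaseSpace N)), (⟨U, V, γ⟩ : Literature.MathematicalPhysics.KineticTheory.HeatConduction.OscillatorChain).IsSteadyState N T_L T_R μ → (⟨fun q => b ^ 2 * U q, fun r => b ^ 2 * V r, b * γ⟩ : Literature.MathematicalPhysics.KineticTheory.HeatConduction.OscillatorChain).IsSteadyState N (b ^ 2 * T_L) (b ^ 2 * T_R) (μ.map fun x => (x.1, b • x.2)) ∧ (⟨fun q => b ^ 2 * U q, fun r => b ^ 2 * V r, b * γ⟩ : Literature.MathematicalPhysics.KineticTheory.HeatConduction.OscillatorChain).totalCurrent (μ.map fun x => (x.1, b • x.2)) = b ^ 3 * (⟨U, V, γ⟩ : Literature.MathematicalPhysics.KineticTheory.HeatConduction.OscillatorChain).totalCurrent μ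

/-- item stmt-AtomisticToContinuum-11830 · support · rank 9 · open · by planner
sources: arXiv:cond-mat/0602082 §2 (2.11)-(2.13) (AokiLukkarinenSpohn2006), decl Literature.Barriers.AtomisticToContinuum.HeatConduction.hasConductivity_of_smul
[support] AMPLITUDE SCALING FOR THE FOUR-COEFFICIENT QUARTIC FAMILY ⟨Aq²/2 + Lq⁴/4, Cr²/2 + Br⁴/4,
γ⟩ (verbatim stmt-AtomisticToContinuum-3284): for s ≠ 0 a steady state of the (Ls², Bs²) chain at
(T_L, T_R) pushes forward under x ↦ s • x to a steady state of the (L, B) chain at (s²T_L, s²T_R),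
totalCurrent scaling by s². Verbatim generalisation of the PROVED isSteadyState_map_smul /
totalCurrent_map_smul (the case A = ω₂, C = 1) to arbitrary harmonic coefficients — needed at A = C
= 0 (the anchor) and (A, C) = (ηω₂, η) (the η-family). [difficulty: provable-now] -/
@[route_item "route-AtomisticToContinuum-ScaleFreeAnchor"]
def QuarticAmplitudeScaling : Prop :=
  ∀ (A L C B γ s : ℝ), s ≠ 0 → ∀ (N : ℕ) (T_L T_R : ℝ) (μ : MeasureTheory.Measure (Literature.MathematicalPhysics.KineticTheory.HeatConduction.PhaseSpace N)), (⟨fun q => A * q ^ 2 / 2 + L * s ^ 2 * q ^ 4 / 4, fun r => C * r ^ 2 / 2 + B * s ^ 2 * r ^ 4 / 4, γ⟩ : Literature.MathematicalPhysics.KineticTheory.HeatConduction.OscillatorChain).IsSteadyState N T_L T_R μ → (⟨fun q => A * q ^ 2 / 2 + L * q ^ 4 / 4, fun r => C * r ^ 2 / 2 + B * r ^ 4 / 4, γ⟩ : Literature.MathematicalPhysics.KineticTheory.HeatConduction.OscillatorChain).IsSteadyState N (s ^ 2 * T_L) (s ^ 2 * T_R) (μ.map fun x => s • x) ∧ (⟨fun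 q => A * q ^ 2 / 2 + L * q ^ 4 / 4, fun r => C * r ^ 2 / 2 + B * r ^ 4 / 4, γ⟩ : Literature.MathematicalPhysics.KineticTheory.HeatConduction.OscillatorChain).totalCurrent (μ.map fun x => s • x) = s ^ 2 * (⟨fun q => A * q ^ 2 / 2 + L * s ^ 2 * q ^ 4 / 4, fun r => C * r ^ 2 / 2 + B * s ^ 2 * r ^ 4 / 4, γ⟩ : Literature.MathematicalPhysics.KineticTheory.HeatConduction.OscillatorChain).totalCurrent μ

/-- item stmt-AtomisticToContinuum-11831 · support · rank 9 · open · by planner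
sources: arXiv:cond-mat/0602082 §2 (2.12)-(2.13) (AokiLukkarinenSpohn2006), doi:10.1103/physreve.87.042125 (LiLi2013)
[support] EXACT SELF-SIMILARITY OF THE ANCHOR (friction–temperature conjugacy; verbatim
stmt-AtomisticToContinuum-3285): for lam, γ and s > 0, (a) FouriersLawFor ⟨lam q⁴/4, r⁴/4, γ⟩ ↔
FouriersLawFor ⟨lam q⁴/4, r⁴/4, sγ⟩, and (b) every conductivity function κ' of the friction-γ anchor
yields the conductivity function T ↦ s·κ'(T/s⁴) of the friction-sγ anchor, i.e. D_N(T, sγ) =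
s·D_N(T/s⁴, γ); at s⁴ = T: D_N(T, γ) = T^{1/4}·D_N(1, γT^{-1/4}) and κ(T) = κ(1)T^{1/4}. Bookkeeping
from TimeRescaling (b = s) and QuarticAmplitudeScaling (A = C = 0, amplitude s). So the anchor's
only genuine parameter is lam (= lam/β of the conjunct). [deps: TimeRescaling,
QuarticAmplitudeScaling] [difficulty: provable-now] -/
@[route_item "route-AtomisticToContinuum-ScaleFreeAnchor"]
def AnchorSelfSimilarity : Prop :=
  ∀ lam γ s : ℝ, 0 < s → ((⟨fun q => lam * q ^ 4 / 4, fun r => r ^ 4 / 4, γ⟩ : Literature.MathematicalPhysics.KineticTheory.HeatConduction.OscillatorChain).FouriersLawFor ↔ (⟨fun q => lam * q ^ 4 / 4, fun r => r ^ 4 / 4, s * γ⟩ : Literature.MathematicalPhysics.KineticTheory.HeatConduction.OscillatorChain).FouriersLawFor) ∧ ∀ κ' : ℝ → ℝ, (∀ μ : (N : ℕ) → ℝ → ℝ → MeasureTheory.Measure (Literature.MathematicalPhysics.KineticTheory.HeatConduction.PhaseSpace N), (∀ (N : ℕ) (T_L T_R : ℝ), 0 < T_L → 0 < T_R → (⟨fun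 q => lam * q ^ 4 / 4, fun r => r ^ 4 / 4, γ⟩ : Literature.MathematicalPhysics.KineticTheory.HeatConduction.OscillatorChain).IsSteadyState N T_L T_R (μ N T_L T_R)) → ∀ T : ℝ, 0 < T → ∃ D : ℕ → ℝ, (∀ N : ℕ, Filter.Tendsto (fun δ : ℝ => (⟨fun q => lam * q ^ 4 / 4, fun r => r ^ 4 / 4, γ⟩ : Literature.MathematicalPhysics.KineticTheory.HeatConduction.OscillatorChain).totalCurrent (μ N (T + δ / 2) (T - δ / 2)) / δ) (nhdsWithin 0 {(0 : ℝ)}ᶜ) (nhds (D N))) ∧ Filter.Tendsto D Filter.atTop (nhds (κ' T))) → ∀ μ : (N : ℕ) → ℝ → ℝ → MeasureTheory.Measure (Literature.MathematicalPhysics.KineticTheory.HeatConduction.PhaseSpace N), (∀ (N : ℕ) (T_L T_R : ℝ), 0 < T_L → 0 < T_R → (⟨fun q => lam * q ^ 4 / 4, fun r => r ^ 4 / 4, s * γ⟩ : Literature.MathematicalPhysics.KineticTheory.HeatConduction.OscillatorChain).IsSteadyState N T_L T_R (μ N T_L T_R)) → ∀ T : ℝ, 0 < T → ∃ D : ℕ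 → ℝ, (∀ N : ℕ, Filter.Tendsto (fun δ : ℝ => (⟨fun q => lam * q ^ 4 / 4, fun r => r ^ 4 / 4, s * γ⟩ : Literature.MathematicalPhysics.KineticTheory.HeatConduction.OscillatorChain).totalCurrent (μ N (T + δ / 2) (T - δ / 2)) / δ) (nhdsWithin 0 {(0 : ℝ)}ᶜ) (nhds (D N))) ∧ Filter.Tendsto D Filter.atTop (nhds (s * κ' (T / s ^ 4)))

/-- item stmt-AtomisticToContinuum-9900 · support · rank 9 · closed · proved by Summit.AtomisticToContinuum.FouriersLaw.Theorems.pinnedSteadyStateExists_proof @ 93199528ccef (prover) · by planner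
sources: arXiv:1712.09413 Thm 2.13 (CuneoEckmannHairerReyBellet2018), decl Literature.MathematicalPhysics.KineticTheory.HeatConduction.pinnedChain_exists_isSteadyState
[support] CLAUSE (i) EXISTENCE FOR THE CONJUNCT'S CHAIN (route-repair 2026-08-15, cone bookkeeping;
provable now; kind support, rank 9): for pinnedChain ω₂ lam β γ with ω₂, lam, β, γ > 0, every N and
all T_L, T_R > 0 there is a weak (Fokker–Planck) steady state (OscillatorChain.IsSteadyState).
PROVED in tree:
Literature.MathematicalPhysics.KineticTheory.HeatConduction.pinnedChain_exists_isSteadyState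
(LangevinChainNESSHolds.lean; the discharged fact CuneoEckmannHairerReyBellet2018_pinnedChain for N
≥ 1 + OscillatorChain.isSteadyState_zero for N = 0) — a Theorems file importing the route file +
LangevinChainNESSHolds closes it in one line (evidence file attached:
PinnedSteadyStateExistsProof.lean, rc 0, axioms propext/Classical.choice/Quot.sound). WHY AN ITEM:
it lets the deciding theorem 'closes' take clause (i) existence as a hypothesis, so that the Theses
file can drop the import Literature.MathematicalPhysics.KineticTheory.LangevinChainNESSHolds
(≈55-module Langevin-SDE cone with the two undischarged Kolmogorov–Chentsov Hölder facts) — the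
pending route-repair edit (imports := [InfiniteChainDynamics], closes re-proved, Assembly restated;
package attached as evidence to the route -/
@[route_item "route-AtomisticToContinuum-ScaleFreeAnchor", crux]
def PinnedSteadyStateExists : Prop :=
  ∀ ω₂ lam β γ : ℝ, 0 < ω₂ → 0 < lam → 0 < β → 0 < γ → ∀ (N : ℕ) (T_L T_R : ℝ), 0 < T_L → 0 < T_R → ∃ μ : MeasureTheory.Measure (Literature.MathematicalPhysics.KineticTheory.HeatConduction.PhaseSpace N), (Literature.MathematicalPhysics.KineticTheory.HeatConduction.pinnedChain ω₂ lam β γ).IsSteadyState N T_L T_R μ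

/-- `PinnedSteadyStateExists` holds: proved by `Summit.AtomisticToContinuum.FouriersLaw.Theorems.pinnedSteadyStateExists_proof` @ 93199528ccef. -/
theorem PinnedSteadyStateExists_holds : PinnedSteadyStateExists := _root_.Summit.AtomisticToContinuum.FouriersLaw.Theorems.pinnedSteadyStateExists_proof

-- earlier Assembly (stmt-AtomisticToContinuum-11832, replaced 2026-08-15T19:40:59Z -> stmt-AtomisticToContinuum-13716): retired by None — AnchorFourier → EtaContinuation → LowTClosure → NessUnique → PinnedSteadyStateExists → FouriersLaw
/-- item stmt-AtomisticToContinuum-13716 · assembly · rank 1 · open · by planner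
sources: BonettoLebowitzReyBellet2000 §5.3 (33), arXiv:cond-mat/0602082 §2
[assembly] HighTFourier → LowTClosure → NessUnique → PinnedSteadyStateExists → FouriersLaw (the
sub-problem Statement decl by name): the high-temperature deliverable (HighTFourier = AnchorFourier
+ EtaContinuation by modus ponens at lam/β, planner theorem highT_of_anchor_eta) + the downward
closure + clause (i) decide the Statement — the plug-in point for any other high-temperature method.
Pure logic + choice, proof on file (planner AssemblyProbe.lean, rc 0: clause (i) from
PinnedSteadyStateExists + NessUnique, clause (ii) HighTFourier tail ⇒ LowTClosure every T ⇒ choose!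
the pointwise constants). The deciding theorem `closes
(AnchorFourier)(EtaContinuation)(LowTClosure)(NessUnique)(PinnedSteadyStateExists) : FouriersLaw` is
unchanged; this Assembly restates the rev-0 one (which was verbatim the type of closes) because rev
1 rendered it BLOCKED (NessUnique re-attached after the dependency check) and an identical
restatement is refused. -/
@[route_item "route-AtomisticToContinuum-ScaleFreeAnchor"]
def Assembly : Prop :=
  HighTFourier → LowTClosure → NessUnique → PinnedSteadyStateExists → FouriersLaw

/-! D-0027 §2.1 — DECIDING THEOREM (planner-authored via `route open/edit --closes-file`; by planner-rrepair-AtomisticToContinuum-ScaleFree-544f5b69-0 2026-08-15T19:37:43Z):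
its hypotheses are this route's items and its conclusion the sub-problem Statement (glue_lint), and it elaborates with this file. -/

@[closes "route-AtomisticToContinuum-ScaleFreeAnchor"] theorem closes (h₁ : AnchorFourier) (h₂ : EtaContinuation) (h₃ : LowTClosure) (h₄ : NessUnique)
    (h₅ : PinnedSteadyStateExists) : FouriersLaw := by
  -- D-0027 §2.1 deciding theorem: conclusion = the sub-problem Statement decl `FouriersLaw` by name.
  intro ω₂ lam β γ hω hlam hβ hγ
  refine ⟨?_, ?_⟩
  · -- clause (i): existence (PinnedSteadyStateExists) + weak-class uniqueness (NessUnique)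
    intro N T_L T_R hTL hTR
    obtain ⟨μ, hμ⟩ := h₅ ω₂ lam β γ hω hlam hβ hγ N T_L T_R hTL hTR
    exact ⟨μ, hμ, fun ν hν => h₄ ω₂ lam β γ hω hlam hβ hγ N T_L T_R hTL hTR ν μ hν hμ⟩
  · -- clause (ii): AnchorFourier at (lam/β, γ') is EtaContinuation's hypothesis ⇒ a tail of Fourier
    -- temperatures; LowTClosure ⇒ every T > 0; glue the pointwise constants into κ by choice.
    have htail := h₂ ω₂ lam β γ hω hlam hβ hγ
      (fun γ' hγ' => h₁ (lam / β) γ' (div_pos hlam hβ) hγ')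
    have hall := h₃ ω₂ lam β γ hω hlam hβ hγ htail
    choose! k hk hkk using hall
    exact ⟨k, hk, fun μ hμ T hT => hkk T hT μ hμ⟩

end Summit.AtomisticToContinuum.FouriersLaw.Theses.ScaleFreeAnchor
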